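import Summits.BirchSwinnertonDyer.Rank1Residual.AdditivePotMult.PotMultCongruentPairGV
import Summits.BirchSwinnertonDyer.Rank1Residual.AdditivePotMult.MixedCongruentPairGV
import Summits.BirchSwinnertonDyer.Rank1Residual.Additive.CongruentPartnerMainConjecture
import HarnessLib

/-!
# Route-G budgets on the (M) rows from a congruent partner via the GV record, EPW-free, with the
# partner input in the WEAK currency "torsion ∧ (μ = 0 ⟹ r₁ ≤ λ)" — the X3♯(M) budget from an
# X3♯(G-ord) or X3♯(M) partner FOR REAL (cell `b2b-bsdres`, team n1011, seat p07 (gen 6); row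
# T-RD-M sequel (vi), consumer of `PotMultCongruentPairGV` (iv) and `MixedCongruentPairGV` (v))

HONEST FRAMING (cell `b2b-bsdres`, run/shared/lean/b2b/bsd-rank1-residual/, verbatim in every
file): the goal of the cell is to DELETE the COMBINATION-SHAPED residual classes of the
Birch–Swinnerton-Dyer formula for ALL analytic-rank `≤ 1` elliptic curves over `ℚ` — "full BSD
formula for every rank `≤ 1` curve in class `C`" assembled STRICTLY from published theorems — so
that the rank-`≤ 1` remainder becomes exactly the CONSTRUCTION-SHAPED classes, which are TYPED
(missing-input `Prop`s), NOT attempted. This is not "finishing BSD". Team n1011 (N10/N11, (M) rows =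
X4(M) / X3♯(M), every odd `p` incl. `3`): research route; labels and marks UNCHANGED; nothing booked.
Consumer theorems only; NO definition; NO Literature fact; named facts as HYPOTHESES: `hGV`
(cc-typer-2's GV §2 composed record
`GreenbergVatsal2000.muLambdaAlg_transfer_of_torsionIso_potOrd_of_not_dvd_torsionOrder`), `hGrK`
(A239, on a (G-ord) partner only), A40/A41 (`hT40`/`hT41`, published Tate uniformisation). Debt 0.

## What

n1011-p10's typed budget `BudgetLeLambdaAt p W b` ("`b ≤ λ(X(E/ℚ_∞))` for every torsion cyclotomic
dual datum with `μ = 0`") on an (M) row `W`, from a CONGRUENT PARTNER `W₁` through the GV record: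

* §0 `budgetLeLambdaAt_of_congruentLambdaShift_of_muTransfer` (reduction-agnostic): X1's typed
  schema `CongruentLambdaShift W W₁ p e` + a `μ = 0` TRANSFER `W → W₁` + a partner whose finitely
  generated cyclotomic dual data are torsion with `μ = 0 ⟹ r₁ ≤ λ` ⟹ `BudgetLeLambdaAt p W b` for
  every `b ≤ r₁ + e` (the receiver's `μ = 0` is a premise of the budget, so the partner's `μ = 0` is
  transferred, not assumed — the weak currency of p07-g3's `budgetLeLambdaAt_of_epw_of_partnerRank`,
  now schema-level).
* §1 the (M)-row budgets with EVERY line / R-D / image binder discharged (gen 5's binder-free GV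
  shifts and `μ`-transfers): generic `PotMult.budgetLeLambdaAt_of_gv_of_torsionIso` ((M)–(M)) and the
  class forms `ClassX4M.budgetLeLambdaAt_of_gv_of_multPartner_of_congr` (X4(M) partner, torsion bits by
  irreducibility), `ClassX4M.…_of_gordPartner_of_congr` (X4♯(G-ord) ∩ `I₀*` partner, `hGrK`),
  `ClassX3M.…_of_multPartner_of_congr` (X3♯(M) partner, ONE census bit `p ∤ #E(ℚ)_tors`),
  `ClassX3M.…_of_gordPartner_of_congr` (X3♯(G-ord) ∩ `I₀*` partner) — `e = Σ_{w∈Σ₀} (δ(E₁,w) − δ(E,w))`.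

On X4(M) this is an EPW-FREE second source of the Route-G budget (p07-g4
`PotMultCongruentPartnerEPWLines`); on X3♯(M) (`ρ̄` REDUCIBLE, EPW 2006 inapplicable — n1011-r2
ROUTE-2 II.13.2) it is the first congruence-sourced budget in the kernel with X1's schema
`CongruentLambdaShift` DISCHARGED (n1011-p12's `ClassX3M.…_of_x3Partner` forms take it as the
hypothesis `hG`): per pair the residual inputs are `hGV`, A40/A41 (`hGrK` with a (G-ord) partner), a
`TorsionIso` certificate, `Σ₀`, one census torsion bit, and a partner with torsion dual data and
`μ = 0 ⟹ r₁ ≤ λ` (sequel `PotMultCongruentPairGVBudgetRank`: from the partner's RANK alone).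
X3♯(M) / X4(M) stay CONSTRUCTION-SHAPED; nothing booked; no mark moved.

References: R. Greenberg, V. Vatsal, Invent. Math. 142 (2000) §2 Props. (2.4), (2.8), Cor. (2.3),
Remark (2.9), pp. 26–27 [GreenbergVatsal2000]; R. Greenberg, LNM 1716 (1999) Prop. 4.14, §2
[GreenbergLNM1716]; B. Mazur, Publ. IHÉS 47 (1977) III §5 [Mazur1977]; J. H. Silverman, *ATAEC*
V.5.3, Cor. V.5.4 [SilvermanATAEC1994]; L. Washington, GTM 83 §13.2 [Washington1997].
-/

noncomputable section

open scoped Classical NumberField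

namespace Summit.BirchSwinnertonDyer.Rank1Residual.AdditivePotMult

open NumberField IsDedekindDomain Field WeierstrassCurve
  Literature.NumberTheory.GaloisRepresentations
  Literature.NumberTheory.EllipticCurves
  Literature.NumberTheory.EllipticCurves.Rank1Residual
  Literature.NumberTheory.EllipticCurves.GreenbergSelmer
  Literature.NumberTheory.EllipticCurves.Greenberg1999
  Literature.NumberTheory.EllipticCurves.GreenbergVatsal2000
  Summit.BirchSwinnertonDyer.Rank1Residual.X1.CongruenceTransfer
  Summit.BirchSwinnertonDyer.Rank1Residual.Additive

variable {p : ℕ} [hp : Fact p.Prime] {W W₁ : WeierstrassCurve ℚ} [W.IsElliptic] [W.IsGloballyMinimal]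
  [W₁.IsElliptic] [W₁.IsGloballyMinimal]

/-! ### §0 The schema-level budget with a `μ = 0` transfer (reduction-agnostic) -/

/-- **A congruent partner supplies the budget — weak partner currency.** `E[p] ≅ E₁[p]`
(`TorsionIso`), X1's typed schema `CongruentLambdaShift W W₁ p e` (`λ(X(E)) = λ(X(E₁)) + e` when both
duals are torsion with `μ = 0`), a `μ = 0` TRANSFER from `E` to `E₁` for torsion cyclotomic dual data
(`hμ`; per pair: GV §2 Prop. (2.8) / EPW 3.3.2), and a partner whose finitely generated cyclotomic
dual data are torsion with `μ(X(E₁)) = 0 ⟹ r₁ ≤ λ(X(E₁))` ⟹ `BudgetLeLambdaAt p W b` for every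
`b ≤ r₁ + e`: given `D` torsion with `μ = 0`, a partner datum `D₁` exists at the same `κ/γ`
(`nonempty_selmerDualData_holds`), `μ(D₁) = 0` by `hμ`, so `b ≤ r₁ + e ≤ λ(D₁) + e = λ(D)`.
[cite: GreenbergVatsal2000, §2 Prop. (2.8), Cor. (2.3) (shape of the schema and of the μ-transfer)]
[cite: Washington1997, §13.2] -/
theorem budgetLeLambdaAt_of_congruentLambdaShift_of_muTransfer {e : ℤ} {r₁ b : ℕ}
    (hiso : TorsionIso W W₁ p) (hG : CongruentLambdaShift W W₁ p e)
    (hμ : ∀ {κ : ZpExtension ℚ p} {γ : absoluteGaloisGroup ℚ},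
      κ.IsCyclotomic → κ.IsTopGenerator γ → IsCyclotomicVariable p γ →
      ∀ (D : W.SelmerDualData κ γ) (D₁ : W₁.SelmerDualData κ γ)
        [Module.Finite (IwasawaAlgebra p) D.X] [Module.Finite (IwasawaAlgebra p) D₁.X],
        D.IsTorsion → D₁.IsTorsion → D.mu = 0 → D₁.mu = 0)
    (h₁ : ∀ {κ : ZpExtension ℚ p} {γ : absoluteGaloisGroup ℚ},
      κ.IsCyclotomic → κ.IsTopGenerator γ → IsCyclotomicVariable p γ →
      ∀ (D₁ : W₁.SelmerDualData κ γ) [Module.Finite (IwasawaAlgebra p) D₁.X],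
        D₁.IsTorsion ∧ (D₁.mu = 0 → r₁ ≤ lambdaInvariant p D₁.X))
    (hb : (b : ℤ) ≤ r₁ + e) : BudgetLeLambdaAt p W b := by
  intro κ γ hκ hγ hγ' D _ hX hmu
  obtain ⟨D₁⟩ := W₁.nonempty_selmerDualData_holds κ γ hγ
  haveI : Module.Finite (IwasawaAlgebra p) D₁.X := D₁.module_finite_holds hγ
  obtain ⟨hX₁, hr₁⟩ := h₁ hκ hγ hγ' D₁
  have hmu₁ : D₁.mu = 0 := hμ hκ hγ hγ' D D₁ hX hX₁ hmu
  have hshift : (lambdaInvariant p D.X : ℤ) = (lambdaInvariant p D₁.X : ℤ) + e :=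
    hG hiso κ γ hκ hγ hγ' D D₁ hX hX₁ hmu hmu₁
  have hle : (b : ℤ) ≤ lambdaInvariant p D.X := by
    rw [hshift]
    have : (r₁ : ℤ) ≤ lambdaInvariant p D₁.X := by exact_mod_cast hr₁ hmu₁
    omega
  exact_mod_cast hle

/-! ### §1 The (M)-row budgets from the GV record — lines, R-D and image binders discharged -/

/-- **(M)–(M) congruent pair, every odd `p`: the Route-G budget of `E = W` from the GV record.**
Inputs: `hGV`, A40/A41; `p ≠ 2`; `PotMult W p`, `PotMult W₁ p`; `p ∤ #E(ℚ)_tors`, `p ∤ #E₁(ℚ)_tors`;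
`TorsionIso W W₁ p`; `Σ₀ ∌ p` outside which both are good; a partner with torsion cyclotomic dual
data and `μ = 0 ⟹ r₁ ≤ λ`. Then `BudgetLeLambdaAt p W b` for every
`b ≤ r₁ + Σ_{w∈Σ₀} (δ(E₁,w) − δ(E,w))` (§0 over gen 5's `PotMult.congruentLambdaShift_of_gv_of_torsionIso`
and `PotMult.mu_eq_zero_of_gv_of_torsionIso`). NO line / R-D / image binder. Nothing booked.
[cite: GreenbergVatsal2000, §2 Prop. (2.8) with Remark (2.9), Cor. (2.3), Prop. (2.4), pp. 26–27 (arXiv:math/9906215)]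
[cite: SilvermanATAEC1994, Ch. V Thm. 5.3, Cor. 5.4] -/
theorem PotMult.budgetLeLambdaAt_of_gv_of_torsionIso
    (hGV : muLambdaAlg_transfer_of_torsionIso_potOrd_of_not_dvd_torsionOrder)
    (hT40 : Silverman1994_thmV53_tateUniformisation.{0})
    (hT41 : Silverman1994_thmV53_corV54_tateUniformisation.{0}) (hp2 : p ≠ 2)
    (hpm : PotMult W p) (hpm₁ : PotMult W₁ p)
    (htors : ¬ p ∣ W.torsionOrder) (htors₁ : ¬ p ∣ W₁.torsionOrder) (hT : TorsionIso W W₁ p)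
    (S₀ : Finset (HeightOneSpectrum (𝓞 ℚ))) (hS₀ : ∀ w ∈ S₀, ((p : ℕ) : 𝓞 ℚ) ∉ w.asIdeal)
    (hS : ∀ w : HeightOneSpectrum (𝓞 ℚ), w ∉ S₀ → ((p : ℕ) : 𝓞 ℚ) ∉ w.asIdeal →
      W.HasGoodReductionAt w)
    (hS₁ : ∀ w : HeightOneSpectrum (𝓞 ℚ), w ∉ S₀ → ((p : ℕ) : 𝓞 ℚ) ∉ w.asIdeal →
      W₁.HasGoodReductionAt w)
    {r₁ : ℕ}
    (h₁ : ∀ {κ : ZpExtension ℚ p} {γ : absoluteGaloisGroup ℚ},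
      κ.IsCyclotomic → κ.IsTopGenerator γ → IsCyclotomicVariable p γ →
      ∀ (D₁ : W₁.SelmerDualData κ γ) [Module.Finite (IwasawaAlgebra p) D₁.X],
        D₁.IsTorsion ∧ (D₁.mu = 0 → r₁ ≤ lambdaInvariant p D₁.X))
    {b : ℕ} (hb : (b : ℤ) ≤ r₁ + ∑ w ∈ S₀, ((delta W₁ p w : ℤ) - (delta W p w : ℤ))) :
    BudgetLeLambdaAt p W b :=
  budgetLeLambdaAt_of_congruentLambdaShift_of_muTransfer hT
    (hpm.congruentLambdaShift_of_gv_of_torsionIso hGV hT40 hT41 hp2 hpm₁ htors htors₁ hT S₀ hS₀ hS hS₁)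
    (fun hκ hγ hγ' D D₁ _ _ hX hX₁ hmu ↦
      hpm.mu_eq_zero_of_gv_of_torsionIso hGV hT40 hT41 hp2 hpm₁ htors htors₁ hT S₀ hS₀ hS hS₁ hκ hγ
        hγ' D D₁ hX hX₁ hmu)
    h₁ hb

/-- **X4(M) row, X4(M) partner: the EPW-free Route-G budget from the GV record** (torsion conditions
by irreducibility, Mazur): `BudgetLeLambdaAt p W b` for `b ≤ r₁ + Σ_{w∈Σ₀} (δ(E₁,w) − δ(E,w))`, the
partner having torsion cyclotomic dual data with `μ = 0 ⟹ r₁ ≤ λ`. Nothing booked.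
[cite: GreenbergVatsal2000, §2 Prop. (2.8) with Remark (2.9), Cor. (2.3), Prop. (2.4), pp. 26–27 (arXiv:math/9906215)]
[cite: Mazur1977, Ch. III §5, p. 157] [cite: SilvermanATAEC1994, Ch. V Thm. 5.3, Cor. 5.4] -/
theorem ClassX4M.budgetLeLambdaAt_of_gv_of_multPartner_of_congr
    (hGV : muLambdaAlg_transfer_of_torsionIso_potOrd_of_not_dvd_torsionOrder)
    (hT40 : Silverman1994_thmV53_tateUniformisation.{0})
    (hT41 : Silverman1994_thmV53_corV54_tateUniformisation.{0})
    (hX : ClassX4M W p) (hX₁ : ClassX4M W₁ p) (hT : TorsionIso W W₁ p)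
    (S₀ : Finset (HeightOneSpectrum (𝓞 ℚ))) (hS₀ : ∀ w ∈ S₀, ((p : ℕ) : 𝓞 ℚ) ∉ w.asIdeal)
    (hS : ∀ w : HeightOneSpectrum (𝓞 ℚ), w ∉ S₀ → ((p : ℕ) : 𝓞 ℚ) ∉ w.asIdeal →
      W.HasGoodReductionAt w)
    (hS₁ : ∀ w : HeightOneSpectrum (𝓞 ℚ), w ∉ S₀ → ((p : ℕ) : 𝓞 ℚ) ∉ w.asIdeal →
      W₁.HasGoodReductionAt w)
    {r₁ : ℕ}
    (h₁ : ∀ {κ : ZpExtension ℚ p} {γ : absoluteGaloisGroup ℚ},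
      κ.IsCyclotomic → κ.IsTopGenerator γ → IsCyclotomicVariable p γ →
      ∀ (D₁ : W₁.SelmerDualData κ γ) [Module.Finite (IwasawaAlgebra p) D₁.X],
        D₁.IsTorsion ∧ (D₁.mu = 0 → r₁ ≤ lambdaInvariant p D₁.X))
    {b : ℕ} (hb : (b : ℤ) ≤ r₁ + ∑ w ∈ S₀, ((delta W₁ p w : ℤ) - (delta W p w : ℤ))) :
    BudgetLeLambdaAt p W b :=
  budgetLeLambdaAt_of_congruentLambdaShift_of_muTransfer hT
    (hX.congruentLambdaShift_of_gv_of_torsionIso hGV hT40 hT41 hX₁ hT S₀ hS₀ hS hS₁)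
    (fun hκ hγ hγ' D D₁ _ _ hXt hX₁t hmu ↦
      hX.mu_eq_zero_of_gv_of_torsionIso hGV hT40 hT41 hX₁ hT S₀ hS₀ hS hS₁ hκ hγ hγ' D D₁ hXt hX₁t
        hmu)
    h₁ hb

/-- **X4(M) row, X4♯(G-ord) ∩ `I₀*` partner: the EPW-free Route-G budget from the GV record**, mod
A40/A41 | `hGrK`; torsion conditions by irreducibility. Nothing booked.
[cite: GreenbergVatsal2000, §2 Prop. (2.8) with Remark (2.9), Cor. (2.3), Prop. (2.4), pp. 26–27 (arXiv:math/9906215)]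
[cite: Mazur1977, Ch. III §5, p. 157] [cite: GreenbergLNM1716, §2 Props. 2.2, 2.4 (pp. 73–75)] -/
theorem ClassX4M.budgetLeLambdaAt_of_gv_of_gordPartner_of_congr
    (hGV : muLambdaAlg_transfer_of_torsionIso_potOrd_of_not_dvd_torsionOrder)
    (hGrK : imKummer_ge_strictCondition_goodOrdinary)
    (hT40 : Silverman1994_thmV53_tateUniformisation.{0})
    (hT41 : Silverman1994_thmV53_corV54_tateUniformisation.{0})
    (hX : ClassX4M W p) (hX₁ : ClassX4Gord W₁ p) (he₁ : semistabilityIndex W₁ p = 2)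
    (hT : TorsionIso W W₁ p)
    (S₀ : Finset (HeightOneSpectrum (𝓞 ℚ))) (hS₀ : ∀ w ∈ S₀, ((p : ℕ) : 𝓞 ℚ) ∉ w.asIdeal)
    (hS : ∀ w : HeightOneSpectrum (𝓞 ℚ), w ∉ S₀ → ((p : ℕ) : 𝓞 ℚ) ∉ w.asIdeal →
      W.HasGoodReductionAt w)
    (hS₁ : ∀ w : HeightOneSpectrum (𝓞 ℚ), w ∉ S₀ → ((p : ℕ) : 𝓞 ℚ) ∉ w.asIdeal →
      W₁.HasGoodReductionAt w)
    {r₁ : ℕ}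
    (h₁ : ∀ {κ : ZpExtension ℚ p} {γ : absoluteGaloisGroup ℚ},
      κ.IsCyclotomic → κ.IsTopGenerator γ → IsCyclotomicVariable p γ →
      ∀ (D₁ : W₁.SelmerDualData κ γ) [Module.Finite (IwasawaAlgebra p) D₁.X],
        D₁.IsTorsion ∧ (D₁.mu = 0 → r₁ ≤ lambdaInvariant p D₁.X))
    {b : ℕ} (hb : (b : ℤ) ≤ r₁ + ∑ w ∈ S₀, ((delta W₁ p w : ℤ) - (delta W p w : ℤ))) :
    BudgetLeLambdaAt p W b :=
  budgetLeLambdaAt_of_congruentLambdaShift_of_muTransfer hT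
    (hX.congruentLambdaShift_of_gv_of_gordPartner hGV hGrK hT40 hT41 hX₁ he₁ hT S₀ hS₀ hS hS₁)
    (fun hκ hγ hγ' D D₁ _ _ hXt hX₁t hmu ↦
      hX.mu_eq_zero_of_gv_of_gordPartner hGV hGrK hT40 hT41 hX₁ he₁ hT S₀ hS₀ hS hS₁ hκ hγ hγ' D D₁
        hXt hX₁t hmu)
    h₁ hb

/-- **X3♯(M) row, X3♯(M) partner (`ρ̄` REDUCIBLE, EPW inapplicable): the Route-G budget from the GV
record** — `BudgetLeLambdaAt p W b` for `b ≤ r₁ + Σ_{w∈Σ₀} (δ(E₁,w) − δ(E,w))`, inputs `hGV`, A40/A41,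
ONE census bit `p ∤ #E(ℚ)_tors` (the partner's follows from `TorsionIso`, cc-typer-2), `TorsionIso`,
`Σ₀`, and a partner with torsion cyclotomic dual data and `μ = 0 ⟹ r₁ ≤ λ`. NO line / R-D / image
binder. X3♯(M) stays CONSTRUCTION-SHAPED; nothing booked.
[cite: GreenbergVatsal2000, §2 Prop. (2.8) with Remark (2.9), Cor. (2.3), Prop. (2.4), pp. 26–27 (arXiv:math/9906215)]
[cite: GreenbergLNM1716, Prop. 4.14] [cite: SilvermanATAEC1994, Ch. V Thm. 5.3, Cor. 5.4] -/
theorem ClassX3M.budgetLeLambdaAt_of_gv_of_multPartner_of_congr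
    (hGV : muLambdaAlg_transfer_of_torsionIso_potOrd_of_not_dvd_torsionOrder)
    (hT40 : Silverman1994_thmV53_tateUniformisation.{0})
    (hT41 : Silverman1994_thmV53_corV54_tateUniformisation.{0})
    (hX : ClassX3M W p) (hX₁ : ClassX3M W₁ p)
    (htors : ¬ p ∣ W.torsionOrder) (hT : TorsionIso W W₁ p)
    (S₀ : Finset (HeightOneSpectrum (𝓞 ℚ))) (hS₀ : ∀ w ∈ S₀, ((p : ℕ) : 𝓞 ℚ) ∉ w.asIdeal)
    (hS : ∀ w : HeightOneSpectrum (𝓞 ℚ), w ∉ S₀ → ((p : ℕ) : 𝓞 ℚ) ∉ w.asIdeal →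
      W.HasGoodReductionAt w)
    (hS₁ : ∀ w : HeightOneSpectrum (𝓞 ℚ), w ∉ S₀ → ((p : ℕ) : 𝓞 ℚ) ∉ w.asIdeal →
      W₁.HasGoodReductionAt w)
    {r₁ : ℕ}
    (h₁ : ∀ {κ : ZpExtension ℚ p} {γ : absoluteGaloisGroup ℚ},
      κ.IsCyclotomic → κ.IsTopGenerator γ → IsCyclotomicVariable p γ →
      ∀ (D₁ : W₁.SelmerDualData κ γ) [Module.Finite (IwasawaAlgebra p) D₁.X],
        D₁.IsTorsion ∧ (D₁.mu = 0 → r₁ ≤ lambdaInvariant p D₁.X))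
    {b : ℕ} (hb : (b : ℤ) ≤ r₁ + ∑ w ∈ S₀, ((delta W₁ p w : ℤ) - (delta W p w : ℤ))) :
    BudgetLeLambdaAt p W b :=
  budgetLeLambdaAt_of_congruentLambdaShift_of_muTransfer hT
    (hX.congruentLambdaShift_of_gv_of_torsionIso hGV hT40 hT41 hX₁ htors hT S₀ hS₀ hS hS₁)
    (fun hκ hγ hγ' D D₁ _ _ hXt hX₁t hmu ↦
      hX.mu_eq_zero_of_gv_of_torsionIso hGV hT40 hT41 hX₁ htors hT S₀ hS₀ hS hS₁ hκ hγ hγ' D D₁ hXt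
        hX₁t hmu)
    h₁ hb

/-- **X3♯(M) row, X3♯(G-ord) ∩ `I₀*` partner: the Route-G budget from the GV record**, mod A40/A41 |
`hGrK`; ONE census bit `p ∤ #E(ℚ)_tors`; NO line / R-D / image binder. Nothing booked.
[cite: GreenbergVatsal2000, §2 Prop. (2.8) with Remark (2.9), Cor. (2.3), Prop. (2.4), pp. 26–27 (arXiv:math/9906215)]
[cite: GreenbergLNM1716, Prop. 4.14, §2 Props. 2.2, 2.4 (pp. 73–75)] [cite: SilvermanATAEC1994, Ch. V Thm. 5.3, Cor. 5.4] -/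
theorem ClassX3M.budgetLeLambdaAt_of_gv_of_gordPartner_of_congr
    (hGV : muLambdaAlg_transfer_of_torsionIso_potOrd_of_not_dvd_torsionOrder)
    (hGrK : imKummer_ge_strictCondition_goodOrdinary)
    (hT40 : Silverman1994_thmV53_tateUniformisation.{0})
    (hT41 : Silverman1994_thmV53_corV54_tateUniformisation.{0})
    (hX : ClassX3M W p) (hX₁ : ClassX3Gord W₁ p) (he₁ : semistabilityIndex W₁ p = 2)
    (htors : ¬ p ∣ W.torsionOrder) (hT : TorsionIso W W₁ p)
    (S₀ : Finset (HeightOneSpectrum (𝓞 ℚ))) (hS₀ : ∀ w ∈ S₀, ((p : ℕ) : 𝓞 ℚ) ∉ w.asIdeal)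
    (hS : ∀ w : HeightOneSpectrum (𝓞 ℚ), w ∉ S₀ → ((p : ℕ) : 𝓞 ℚ) ∉ w.asIdeal →
      W.HasGoodReductionAt w)
    (hS₁ : ∀ w : HeightOneSpectrum (𝓞 ℚ), w ∉ S₀ → ((p : ℕ) : 𝓞 ℚ) ∉ w.asIdeal →
      W₁.HasGoodReductionAt w)
    {r₁ : ℕ}
    (h₁ : ∀ {κ : ZpExtension ℚ p} {γ : absoluteGaloisGroup ℚ},
      κ.IsCyclotomic → κ.IsTopGenerator γ → IsCyclotomicVariable p γ →
      ∀ (D₁ : W₁.SelmerDualData κ γ) [Module.Finite (IwasawaAlgebra p) D₁.X],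
        D₁.IsTorsion ∧ (D₁.mu = 0 → r₁ ≤ lambdaInvariant p D₁.X))
    {b : ℕ} (hb : (b : ℤ) ≤ r₁ + ∑ w ∈ S₀, ((delta W₁ p w : ℤ) - (delta W p w : ℤ))) :
    BudgetLeLambdaAt p W b :=
  budgetLeLambdaAt_of_congruentLambdaShift_of_muTransfer hT
    (hX.congruentLambdaShift_of_gv_of_gordPartner hGV hGrK hT40 hT41 hX₁ he₁ htors hT S₀ hS₀ hS hS₁)
    (fun hκ hγ hγ' D D₁ _ _ hXt hX₁t hmu ↦
      hX.mu_eq_zero_of_gv_of_gordPartner hGV hGrK hT40 hT41 hX₁ he₁ htors hT S₀ hS₀ hS hS₁ hκ hγ hγ'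
        D D₁ hXt hX₁t hmu)
    h₁ hb

end Summit.BirchSwinnertonDyer.Rank1Residual.AdditivePotMult

end
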